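import Literature.MathematicalPhysics.QuantumFieldTheory.Balaban1983to89.B6GlobalChartV1
import Literature.MathematicalPhysics.QuantumFieldTheory.Balaban1983to89.B6Prop22KLevelTorusCensus

/-!
# `Balaban1983to89.B6V1TorusWitness` — [B6] (2.1)–(2.4) p. 224: NON-VACUITY OF THE HYPOTHESIS SET OF ROUTE V ON THE V1 CARRIER —
# nested torus families `D : TDomains d ℓ M_h k P′ R` with GENUINELY two top levels whose torus IS the V1 torus
# (`N₀ = 2L^{m+K}`, r03's `hN`), with p21's side conditions `P′_μ ≥ 4`, `R ≥ 2L`, and `L·M_h` beyond every threshold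

statement-level skeleton of published theorems with citation tags; proofs where landed; nothing here is a claim about the Yang–Mills mass gap

Source under audit (cell pub-balaban / lit-balaban): T. Bałaban, *Propagators and renormalization transformations for lattice gauge
theories. II*, Commun. Math. Phys. **96** (1984) 223–250 [`Balaban1984PropagatorsII`, "B6"], (2.1)–(2.4) p. 224 («a sequence of domains
Ω₁ ⊃ Ω₂ ⊃ … ⊃ Ω_k, Ω_j ⊂ T_η … we admit the case when some domains Ω_j are equal to T_η»).  Unit `lit-balaban-p22` (Phase-2 proof seat
p22 gen 19), HOME `run/shared/lean/pub/lit-balaban/`, free-target protocol G.5-34(d); B6-CLOSURE §5 item 13 (ROUTE V, (d5-b)) of the fold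
owner r03; referee ref-4.

## WHY THIS FILE

The genuine `k`-level Proposition 2.6 on the V1 carrier (r03's `B6GlobalChartV1.prop26_2136_V1_of_2134_eq291` and its assembly) binds
`(m K : ℕ) {Mh k R : ℕ} {P′} (hN : ∀ μ, N0 ℓ Mh k P′ μ = (PV d ℓ m K hd hL).sitesPerDir 0) (D : TDomains d ℓ Mh k P′ R) (hk : k ≤ m + K)`,
and the torus inputs of p21 ((2.87) `B6Prop23MultiLevelTorus`, (2.88)_T, the census index `KTIdx`) add `1 ≤ M_h`, `4 ≤ P′_μ`, `2L ≤ R` and a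
largeness threshold `M₀ ≤ L·M_h`; the dictionary `B6ScalarChartV1.hasMajorant_Dg_chart` lives over exactly this data.  p21's non-vacuity
witnesses (`KTIdx.twoTopT`, `kLevelTorus_nonvacuous`) fix `P_μ = 4`, which is INCOMPATIBLE with `hN` for odd `L` (`4·M_h·L^{k+1} = 2L^{m+K}`
forces `2M_h = L^n`).  THIS FILE records that the joint hypothesis set is inhabited beyond every threshold, with blocks at BOTH top levels
`k` and `k − 1` (so the statements are about genuinely multi-level geometries): `M_h := L^a`, `P′_μ := 2L`, `R := 2L`, `m + K = k + a + 2`,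
level function p21's `KTIdx.topLev` (`Ω₁ = … = Ω_{k−1} = T_η`, `Ω_k` = the big `k`-block at the origin; (2.1) by construction, (2.2) void).

## WHAT THIS FILE CERTIFIES (theorems only; no `def`, no new fact)

* `N0_V1` — `N0 ℓ (L^a) k (2L) = (PV d ℓ m K).sitesPerDir 0` whenever `m + K = k + a + 2`;
* `topLev_zero`, `topLev_corner`, `corner_mem_boxDom` — the origin has level `k`, the corner of the neighbouring big `k`-block is a site
  of the torus (for `P_μ ≥ 2`) of level `k − 1` (p21's `twoTopT_lev_zero`/`twoTopT_lev_corner` freed from `P = 4`);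
* `exists_twoTop_TDomains` — for every `P`, `R` and `k ≥ 2` a torus family with level function `topLev`;
* **`v1Torus_nonvacuous`** — the package in r03's binders: `∃ a m K Mh R P′ D, hN ∧ k ≤ m + K ∧ 1 ≤ Mh ∧ (∀ μ, 4 ≤ P′ μ) ∧ 2L ≤ R ∧
  M₃ ≤ L·M_h ∧ (∃ x, lev x = k) ∧ (∃ x, lev x = k − 1)`; **`v1Torus_nonvacuous_KTIdx`** — the same as a member `i : KTIdx d ℓ` of p21's
  torus census family (for the `KTIdx`-indexed torus theorems).

HONEST SCOPE.  Bookkeeping only ((2.1)–(2.4) as recorded by `TDomains`); the witness family has exactly two levels `k − 1, k` (the torus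
(2.2) is void for it), as p21's; nothing on d = 4 or the continuum; NOT summit progress.
-/

namespace Literature.MathematicalPhysics.QuantumFieldTheory.Balaban1983to89.B6V1TorusWitness

open Literature.MathematicalPhysics.QuantumFieldTheory.Balaban1983to89.B4Reflection242 (boxDom mem_boxDom blk)
open Literature.MathematicalPhysics.QuantumFieldTheory.Balaban1983to89.B6MultiLevelBoxOperator (N0 bigSide one_le_bigSide)
open Literature.MathematicalPhysics.QuantumFieldTheory.Balaban1983to89.B6MultiLevelTorusOperator (TDomains N0_eq_bigSide_mul)
open Literature.MathematicalPhysics.QuantumFieldTheory.Balaban1983to89.B6Prop22KLevelTorusCensus (KTIdx)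
open Literature.MathematicalPhysics.QuantumFieldTheory.Balaban1983to89.B6GlobalChartV1 (PV)

variable {d : ℕ}

/-! ## §1 The V1 torus size -/

/-- **THE V1 TORUS IS A (2.1)-TORUS**: with `M_h = L^a`, `P′_μ = 2L` and `m + K = k + a + 2` the torus side
`N₀ = L^k·L·M_h·P′ = 2L^{m+K}` is the number of sites per direction of the V1 unit lattice. [cite: Balaban1984PropagatorsII, (2.1) p.224, dictionary] -/
theorem N0_V1 (ℓ k a m K : ℕ) (hd : 1 ≤ d + 1) (hL : Odd (ℓ + 1) ∧ 1 < ℓ + 1) (hmK : m + K = k + a + 2) (μ : Fin (d + 1)) :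
    N0 ℓ ((ℓ + 1) ^ a) k (fun _ => 2 * (ℓ + 1)) μ = (PV d ℓ m K hd hL).sitesPerDir 0 := by
  show (ℓ + 1) ^ k * ((ℓ + 1) * ((ℓ + 1) ^ a * (2 * (ℓ + 1)))) = 2 * (ℓ + 1) ^ (m + K - 0)
  rw [Nat.sub_zero, hmK]
  ring

/-! ## §2 p21's two-top-level function, for every torus size -/

/-- the origin has level `k` under `topLev`. [cite: Balaban1984PropagatorsII, (2.1) p.224] -/
theorem topLev_zero (ℓ k Mh : ℕ) : KTIdx.topLev (d := d) ℓ k Mh 0 = k := by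
  unfold KTIdx.topLev
  have hb : blk (bigSide ℓ Mh k) (0 : Fin (d + 1) → ℤ) = 0 := by funext μ; simp [blk]
  rw [if_pos hb]

/-- the corner of the neighbouring big `k`-block (first direction) has level `k − 1` under `topLev`. [cite: Balaban1984PropagatorsII, (2.1) p.224] -/
theorem topLev_corner (ℓ k Mh : ℕ) (hMh : 1 ≤ Mh) :
    KTIdx.topLev (d := d) ℓ k Mh (fun μ : Fin (d + 1) => if μ = 0 then ((bigSide ℓ Mh k : ℕ) : ℤ) else 0) = k - 1 := by
  unfold KTIdx.topLev
  have hpos : 1 ≤ bigSide ℓ Mh k := one_le_bigSide hMh _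
  have hb : blk (bigSide ℓ Mh k) (fun μ : Fin (d + 1) => if μ = 0 then ((bigSide ℓ Mh k : ℕ) : ℤ) else 0)
      = fun μ => if μ = 0 then 1 else 0 := by
    funext μ; simp only [blk]
    have hne : ((bigSide ℓ Mh k : ℕ) : ℤ) ≠ 0 := by exact_mod_cast (by omega : bigSide ℓ Mh k ≠ 0)
    split_ifs
    · exact Int.ediv_self hne
    · simp
  have hnot : (fun μ : Fin (d + 1) => if μ = 0 then (1 : ℤ) else 0) ≠ 0 := by
    intro h
    have := congrFun h 0; simp at this
  rw [hb, if_neg hnot]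

/-- … and is a site of the torus as soon as `P_μ ≥ 2`. [cite: Balaban1984PropagatorsII, (2.1) p.224] -/
theorem corner_mem_boxDom (ℓ k Mh : ℕ) (P : Fin (d + 1) → ℕ) (hMh : 1 ≤ Mh) (hP : ∀ μ, 2 ≤ P μ) :
    (fun μ : Fin (d + 1) => if μ = 0 then ((bigSide ℓ Mh k : ℕ) : ℤ) else 0) ∈ boxDom (N0 ℓ Mh k P) := by
  rw [mem_boxDom]; intro μ
  rw [N0_eq_bigSide_mul]
  have hpos : 1 ≤ bigSide ℓ Mh k := one_le_bigSide hMh _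
  have h2 : bigSide ℓ Mh k * 2 ≤ bigSide ℓ Mh k * P μ := Nat.mul_le_mul_left _ (hP μ)
  split_ifs
  · constructor
    · positivity
    · push_cast
      have : ((bigSide ℓ Mh k * 2 : ℕ) : ℤ) ≤ ((bigSide ℓ Mh k * P μ : ℕ) : ℤ) := by exact_mod_cast h2
      push_cast at this; linarith [(show (1 : ℤ) ≤ bigSide ℓ Mh k by exact_mod_cast hpos)]
  · constructor
    · exact le_rfl
    · push_cast
      have : ((bigSide ℓ Mh k * 2 : ℕ) : ℤ) ≤ ((bigSide ℓ Mh k * P μ : ℕ) : ℤ) := by exact_mod_cast h2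
      push_cast at this; nlinarith [(show (1 : ℤ) ≤ bigSide ℓ Mh k by exact_mod_cast hpos)]

/-- **THE TWO-TOP-LEVEL FAMILY ON EVERY TORUS**: for every `k ≥ 2`, `M_h`, `P`, `R` a nested family `Ω₁ = … = Ω_{k−1} = T_η`,
`Ω_k` = the big `k`-block at the origin, i.e. level function `topLev` ((2.1) by construction, (2.2) void) — p21's `KTIdx.twoTopT`
freed from `P = 4`, `R = 2L`. [cite: Balaban1984PropagatorsII, (2.1)–(2.2) p.224] -/
theorem exists_twoTop_TDomains (d ℓ Mh k : ℕ) (P : Fin (d + 1) → ℕ) (R : ℕ) (hk : 2 ≤ k) :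
    ∃ D : TDomains d ℓ Mh k P R, D.lev = KTIdx.topLev ℓ k Mh := by
  refine ⟨{ lev := KTIdx.topLev ℓ k Mh
            one_le_lev := fun x => by rcases KTIdx.topLev_eq_or (d := d) ℓ k Mh x with h | h <;> omega
            lev_le := fun x => by rcases KTIdx.topLev_eq_or (d := d) ℓ k Mh x with h | h <;> omega
            bigBlocks := ?_
            sepT := ?_ }, rfl⟩
  · intro j hj x _ x' _ hb
    by_cases hjk : j ≤ k - 1
    · constructor <;> intro _
      · rcases KTIdx.topLev_eq_or (d := d) ℓ k Mh x' with h | h <;> omega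
      · rcases KTIdx.topLev_eq_or (d := d) ℓ k Mh x with h | h <;> omega
    by_cases hje : j = k
    · subst hje
      have key : ∀ y : Fin (d + 1) → ℤ, j ≤ KTIdx.topLev (d := d) ℓ j Mh y ↔ blk (bigSide ℓ Mh j) y = 0 := by
        intro y; unfold KTIdx.topLev; split_ifs with h
        · simp [h]
        · simp only [h, iff_false, not_le]; omega
      rw [key, key, hb]
    · constructor <;> intro h
      · rcases KTIdx.topLev_eq_or (d := d) ℓ k Mh x with e | e <;> omega
      · rcases KTIdx.topLev_eq_or (d := d) ℓ k Mh x' with e | e <;> omega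
  · intro j x _ x' _ h1 h2
    rcases KTIdx.topLev_eq_or (d := d) ℓ k Mh x with e | e <;> rcases KTIdx.topLev_eq_or (d := d) ℓ k Mh x' with e' | e' <;>
      simp only [e, e'] at h1 h2 <;> omega

/-! ## §3 The threshold -/

/-- `L·L^a` exceeds every real threshold (`L ≥ 2`). [folklore] -/
private theorem exists_pow_ge (ℓ : ℕ) (hℓ : 1 ≤ ℓ) (M₃ : ℝ) : ∃ a : ℕ, M₃ ≤ ((ℓ : ℝ) + 1) * (((ℓ + 1) ^ a : ℕ) : ℝ) := by
  refine ⟨⌈M₃⌉₊, ?_⟩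
  have h1 : M₃ ≤ (⌈M₃⌉₊ : ℝ) := Nat.le_ceil M₃
  have h2 : (⌈M₃⌉₊ : ℕ) ≤ (ℓ + 1) ^ ⌈M₃⌉₊ := (Nat.lt_pow_self (by omega : 1 < ℓ + 1)).le
  have h3 : ((ℓ + 1) ^ ⌈M₃⌉₊ : ℕ) ≤ (ℓ + 1) * (ℓ + 1) ^ ⌈M₃⌉₊ := Nat.le_mul_of_pos_left _ (by omega)
  have h4 : (⌈M₃⌉₊ : ℝ) ≤ (((ℓ + 1) * (ℓ + 1) ^ ⌈M₃⌉₊ : ℕ) : ℝ) := by exact_mod_cast h2.trans h3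
  calc M₃ ≤ (⌈M₃⌉₊ : ℝ) := h1
    _ ≤ (((ℓ + 1) * (ℓ + 1) ^ ⌈M₃⌉₊ : ℕ) : ℝ) := h4
    _ = ((ℓ : ℝ) + 1) * (((ℓ + 1) ^ ⌈M₃⌉₊ : ℕ) : ℝ) := by push_cast; ring

/-! ## §4 The packages -/

/-- **NON-VACUITY OF ROUTE V'S HYPOTHESIS SET ON THE V1 CARRIER**: for every `k ≥ 2` and every threshold `M₃` there are V1 parameters
`m, K` and a nested torus family `D : TDomains d ℓ M_h k P′ R` whose torus IS the V1 torus (`hN`), with `k ≤ m + K`, `M_h ≥ 1`,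
`P′_μ ≥ 4`, `R ≥ 2L`, `L·M_h ≥ M₃`, and with sites at BOTH top levels `k` and `k − 1`. [cite: Balaban1984PropagatorsII, (2.1)–(2.4) p.224 («we admit the case when some domains Ω_j are equal to T_η»), Prop. 2.2 p.234 («M is sufficiently large»)] -/
theorem v1Torus_nonvacuous (d ℓ k : ℕ) (hd : 1 ≤ d + 1) (hL : Odd (ℓ + 1) ∧ 1 < ℓ + 1) (hk : 2 ≤ k) (M₃ : ℝ) :
    ∃ (a m K Mh R : ℕ) (P' : Fin (d + 1) → ℕ) (D : TDomains d ℓ Mh k P' R),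
      (∀ μ, N0 ℓ Mh k P' μ = (PV d ℓ m K hd hL).sitesPerDir 0) ∧ k ≤ m + K ∧ 1 ≤ Mh ∧ (∀ μ, 4 ≤ P' μ) ∧ 2 * (ℓ + 1) ≤ R ∧
      M₃ ≤ ((ℓ : ℝ) + 1) * Mh ∧ Mh = (ℓ + 1) ^ a ∧
      (∃ x ∈ boxDom (N0 ℓ Mh k P'), D.lev x = k) ∧ (∃ x ∈ boxDom (N0 ℓ Mh k P'), D.lev x = k - 1) := by
  have hℓ : 1 ≤ ℓ := by have := hL.2; omega
  obtain ⟨a, ha⟩ := exists_pow_ge ℓ hℓ M₃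
  have hMh : 1 ≤ (ℓ + 1) ^ a := Nat.one_le_pow _ _ (by omega)
  have hP2 : ∀ μ : Fin (d + 1), 2 ≤ (fun _ : Fin (d + 1) => 2 * (ℓ + 1)) μ := fun μ => by simp only; omega
  obtain ⟨D, hD⟩ := exists_twoTop_TDomains d ℓ ((ℓ + 1) ^ a) k (fun _ => 2 * (ℓ + 1)) (2 * (ℓ + 1)) hk
  refine ⟨a, k + a + 2, 0, (ℓ + 1) ^ a, 2 * (ℓ + 1), fun _ => 2 * (ℓ + 1), D, fun μ => N0_V1 ℓ k a (k + a + 2) 0 hd hL rfl μ,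
    by omega, hMh, fun μ => show 4 ≤ 2 * (ℓ + 1) by omega, le_rfl, ha, rfl, ?_, ?_⟩
  · refine ⟨0, ?_, by rw [hD]; exact topLev_zero ℓ k _⟩
    rw [mem_boxDom]; intro μ
    have := B6MultiLevelTorusOperator.one_le_N0 (ℓ := ℓ) (k := k) hMh (fun μ => le_trans (by norm_num) (hP2 μ)) μ
    simp only [Pi.zero_apply]; exact ⟨le_rfl, by exact_mod_cast this⟩
  · exact ⟨_, corner_mem_boxDom ℓ k _ _ hMh hP2, by rw [hD]; exact topLev_corner ℓ k _ hMh⟩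

/-- **THE SAME AS A MEMBER OF p21's TORUS CENSUS FAMILY**: an index `i : KTIdx d ℓ` with `i.k = k`, whose torus is the V1 torus of some
`(m, K)` with `k ≤ m + K`, `L·M_h ≥ M₃`, and blocks at both top levels — for the `KTIdx`-indexed torus theorems ((2.67)_T, (2.87)_T, (2.88)_T).
[cite: Balaban1984PropagatorsII, (2.1)–(2.4) p.224, Prop. 2.2 p.234 («M is sufficiently large»)] -/
theorem v1Torus_nonvacuous_KTIdx (d ℓ k : ℕ) (hd : 1 ≤ d + 1) (hL : Odd (ℓ + 1) ∧ 1 < ℓ + 1) (hk : 2 ≤ k) (M₃ : ℝ) :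
    ∃ (i : KTIdx d ℓ) (m K : ℕ), i.k = k ∧ (∀ μ, N0 ℓ i.Mh i.k i.P μ = (PV d ℓ m K hd hL).sitesPerDir 0) ∧ i.k ≤ m + K ∧
      M₃ ≤ ((ℓ : ℝ) + 1) * i.Mh ∧
      (∃ x ∈ boxDom (N0 ℓ i.Mh i.k i.P), i.D.lev x = k) ∧ (∃ x ∈ boxDom (N0 ℓ i.Mh i.k i.P), i.D.lev x = k - 1) := by
  obtain ⟨a, m, K, Mh, R, P', D, hN, hkm, hMh, hP4, hR, hM, -, hx, hx'⟩ := v1Torus_nonvacuous d ℓ k hd hL hk M₃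
  exact ⟨⟨k, Mh, R, P', D, by omega, hMh, hR, hP4⟩, m, K, rfl, hN, hkm, hM, hx, hx'⟩

end Literature.MathematicalPhysics.QuantumFieldTheory.Balaban1983to89.B6V1TorusWitness
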